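import Summits.NavierStokesRegularity.NavierStokesRegularity.Theorems.LerayQuarterDissipationRecurrentReductionDSobolev
import Literature.Analysis.FluidPDE.TypeIAncientMild
import Literature.Analysis.FluidPDE.NSBoundedMildOseenRestart
import Literature.Analysis.FluidPDE.NSLerayBlowupRateLpProofs
import Literature.Analysis.FluidPDE.OseenDuhamelPairCalculus
import Literature.Analysis.UnboundedOperators.HeatKernelBoundedData
import Mathlib.Analysis.SpecialFunctions.Pow.Asymptotics
import HarnessLib

/-!
# Route `LerayQuarterDissipation`, item `RecurrentReductionD` (stmt-NavierStokesRegularity-22507):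
# the slices of a finite-dissipation Type-I ancient mild field are in `L⁶`

Helper file (theorems only, `--supports` the item). Let `u` be a Type-I ancient mild field in
the KNSS gauge (`IsTypeIAncientMild C u`) whose slice gradients are square integrable,
`∫‖∇u(s)‖² < ∞` for every `s < 0` (as for the members of the route's stratum `𝒟`). By the
Sobolev inequality modulo constants (`exists_sub_const_eLpNorm_six_le`) every slice has a
"value at infinity" `b(s)` with `u(s) − b(s) ∈ L⁶`. This file shows that **`b ≡ 0`**, so that

  `‖u(s)‖_{L⁶} ≤ C_S ‖∇u(s)‖_{L²}`  for every `s < 0`   (`exists_eLpNorm_six_slice_le`),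

`C_S` universal. Mechanism (Koch–Nadirashvili–Seregin–Šverák 2009, proof of Thm. 6.1, last
paragraph: "it follows easily that `b` must vanish"): average the Oseen integral identity
`u(t) = e^{(t−s)Δ}u(s) − B_s(u,u)(t)` with the heat kernel at a large scale `√ρ`, i.e. apply
`e^{ρΔ}(·)(0)`. The heat average of a bounded `L⁶` function is `O(ρ^{−1/4})`
(`norm_heatExtension_le_of_eLpNorm_six`), so `e^{ρΔ}u(t)(0) → b(t)` and, by the semigroup law,
`e^{ρΔ}e^{(t−s)Δ}u(s)(0) = e^{(ρ+t−s)Δ}u(s)(0) → b(s)`; the heat flow shifts the clocks of the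
Duhamel term (`heatExtension_oseenDuhamel_eq_setIntegral`), whose slices with clock `≥ ρ` are
`O(ρ^{−1/2})` by the slice estimate `‖N_σ[a,b]‖ ≤ C₀σ^{−1/2}‖a‖_∞‖b‖_∞`. Hence `b(t) = b(s)`
(`constAtInfinity_eq`); and a constant `b` with `‖b‖ ≤ ‖u(s)‖_∞ ≤ C/√(−s) → 0` (`s → −∞`)
vanishes.

References: G. Koch, N. Nadirashvili, G. Seregin, V. Šverák, Acta Math. 203 (2009) =
arXiv:0709.3599, §4 p. 8 and proof of Thm. 6.1 (p. 12) [KochNadirashviliSereginSverak2009].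
-/

noncomputable section

-- the summit and its single problem share the name (D-0017 nested layout)
set_option linter.dupNamespace false

namespace Summit.NavierStokesRegularity.NavierStokesRegularity.Theorems.RecurrentReductionD

open MeasureTheory Set Function Filter Topology Metric
open Literature.Analysis Literature.Analysis.FluidPDE Literature.Analysis.UnboundedOperators
open scoped ENNReal NNReal

/-! ### The heat average of a bounded `L⁶` function -/

/-- **`L⁶ → L^∞` for the heat flow on `ℝ³`, at every point**: if `v` is continuous, bounded,
with `‖v‖_{L⁶} ≤ N`, then `‖(e^{σΔ}v)(x)‖ ≤ N σ^{−1/4}` for `σ > 0` (the tree's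
`eLpNorm_top_heatExtension_le_of_Lr` with `r = 6`, and continuity of the caloric extension).
[cite: OzanskiPooley2018, (6.65) p. 143] -/
theorem norm_heatExtension_le_of_eLpNorm_six
    {v : EuclideanSpace ℝ (Fin 3) → EuclideanSpace ℝ (Fin 3)} (hvc : Continuous v) {Mv : ℝ}
    (hvb : ∀ x, ‖v x‖ ≤ Mv) {N σ : ℝ} (hN : 0 ≤ N) (hvN : eLpNorm v 6 volume ≤ ENNReal.ofReal N)
    (hσ : 0 < σ) (x : EuclideanSpace ℝ (Fin 3)) :
    ‖heatExtension v σ x‖ ≤ N * σ ^ (-(1 / 4 : ℝ)) := by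
  have hvN' : eLpNorm v (ENNReal.ofReal 6) volume ≤ ENNReal.ofReal N := by
    rwa [show ENNReal.ofReal 6 = (6 : ℝ≥0∞) by norm_num]
  have h := eLpNorm_top_heatExtension_le_of_Lr hvc.aestronglyMeasurable (r := 6) (by norm_num) hN
    hvN' hσ
  have hexp : -(3 / (2 * (6 : ℝ))) = -(1 / 4 : ℝ) := by norm_num
  rw [hexp, eLpNorm_exponent_top] at h
  have hcont : Continuous (heatExtension v σ) :=
    (contDiff_heatExtension_of_bound hvc hvb hσ (m := 0)).continuous
  have hb0 : 0 ≤ N * σ ^ (-(1 / 4 : ℝ)) := mul_nonneg hN (Real.rpow_nonneg hσ.le _)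
  have hae : ∀ᵐ y ∂(volume : Measure (EuclideanSpace ℝ (Fin 3))),
      ‖heatExtension v σ y‖ ≤ N * σ ^ (-(1 / 4 : ℝ)) := by
    filter_upwards [ae_le_eLpNormEssSup (f := heatExtension v σ)
      (μ := (volume : Measure (EuclideanSpace ℝ (Fin 3))))] with y hy
    have := hy.trans h
    rwa [← ofReal_norm, ENNReal.ofReal_le_ofReal_iff hb0] at this
  exact forall_norm_le_of_ae_norm_le hcont hae x

/-- The heat average of `b + v` at scale `ρ` differs from `b` by at most `N ρ^{−1/4}` when
`v` is continuous, bounded, `‖v‖_{L⁶} ≤ N`: `e^{ρΔ}(b + v)(x) = b + e^{ρΔ}v(x)`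
(`heatExtension_add_of_bound`, `heatExtension_const`). [folklore] -/
theorem norm_heatExtension_sub_const_le {f : EuclideanSpace ℝ (Fin 3) → EuclideanSpace ℝ (Fin 3)}
    (hfc : Continuous f) {Mf : ℝ} (hfb : ∀ x, ‖f x‖ ≤ Mf) (b : EuclideanSpace ℝ (Fin 3))
    {N ρ : ℝ} (hN : 0 ≤ N) (hvN : eLpNorm (fun x => f x - b) 6 volume ≤ ENNReal.ofReal N)
    (hρ : 0 < ρ) (x : EuclideanSpace ℝ (Fin 3)) :
    ‖heatExtension f ρ x - b‖ ≤ N * ρ ^ (-(1 / 4 : ℝ)) := by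
  have hvc : Continuous fun y => f y - b := hfc.sub continuous_const
  have hvb : ∀ y, ‖f y - b‖ ≤ Mf + ‖b‖ := fun y => (norm_sub_le _ _).trans (by linarith [hfb y])
  have e : f = fun y => (fun _ => b) y + (f y - b) := by funext y; simp
  have h1 : heatExtension f ρ x = b + heatExtension (fun y => f y - b) ρ x := by
    conv_lhs => rw [e]
    rw [heatExtension_add_of_bound continuous_const hvc (fun _ => le_rfl) hvb hρ x,
      heatExtension_const b hρ x]
  rw [h1, add_sub_cancel_left]
  exact norm_heatExtension_le_of_eLpNorm_six hvc hvb hN hvN hρ x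

/-! ### The value at infinity of the slices is constant in time -/

/-- **The values at infinity of two slices of a Type-I ancient mild field agree.** If
`u(s) − b_s ∈ L⁶` and `u(t) − b_t ∈ L⁶` for `s < t < 0`, then `b_t = b_s`: heat-average the Oseen
identity `u(t) = e^{(t−s)Δ}u(s) − B_s(u,u)(t)` at scale `√ρ` at the origin
(`e^{ρΔ}u(t)(0) = e^{(ρ+t−s)Δ}u(s)(0) − ∫_{(s,t)} N_{t+ρ−τ}[u(τ),u(τ)](0) dτ`, semigroup law and
`heatExtension_oseenDuhamel_eq_setIntegral`), and let `ρ → ∞`: the two caloric terms tend to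
`b_t`, `b_s` (`norm_heatExtension_sub_const_le`) and the Duhamel term is
`≤ (t−s) C₀ ρ^{−1/2} (C/√(−t))²`. [cite: KochNadirashviliSereginSverak2009, §4 p. 8 and proof of Thm. 6.1 p. 12 (arXiv:0709.3599)] -/
theorem constAtInfinity_eq {C : ℝ} {u : ℝ → EuclideanSpace ℝ (Fin 3) → EuclideanSpace ℝ (Fin 3)}
    (hu : IsTypeIAncientMild C u) {s t : ℝ} (hst : s < t) (ht : t < 0)
    {bs bt : EuclideanSpace ℝ (Fin 3)} {Ns Nt : ℝ} (hNs : 0 ≤ Ns) (hNt : 0 ≤ Nt)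
    (hvs : eLpNorm (fun x => u s x - bs) 6 volume ≤ ENNReal.ofReal Ns)
    (hvt : eLpNorm (fun x => u t x - bt) 6 volume ≤ ENNReal.ofReal Nt) : bt = bs := by
  have hs : s < 0 := hst.trans ht
  have hts : 0 < t - s := sub_pos.2 hst
  have hC : 0 ≤ C := hu.nonneg
  -- bounds and continuity of the slices
  set Ms : ℝ := C / Real.sqrt (-s) with hMs
  set Mt : ℝ := C / Real.sqrt (-t) with hMt
  have hMt0 : 0 ≤ Mt := div_nonneg hC (Real.sqrt_nonneg _)
  have hus : ∀ y, ‖u s y‖ ≤ Ms := fun y => hu.norm_le hs y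
  have hut : ∀ y, ‖u t y‖ ≤ Mt := fun y => hu.norm_le ht y
  have hcs : Continuous (u s) := hu.continuous_slice hs
  have hct : Continuous (u t) := hu.continuous_slice ht
  -- the free term `H = e^{(t-s)Δ} u(s)` and the Duhamel term `B = H - u(t)`
  set H : EuclideanSpace ℝ (Fin 3) → EuclideanSpace ℝ (Fin 3) := heatExtension (u s) (t - s) with hH
  have hHc : Continuous H := (contDiff_heatExtension_of_bound hcs hus hts (m := 0)).continuous
  have hHb : ∀ y, ‖H y‖ ≤ Ms := fun y => norm_heatExtension_le hus hts y
  set B : EuclideanSpace ℝ (Fin 3) → EuclideanSpace ℝ (Fin 3) := oseenDuhamel 1 s u u t with hB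
  have hmild : ∀ y, u t y = H y - B y := fun y => hu.mild_eq_heatExtension hst ht y
  have hBeq : B = fun y => H y - u t y := by
    funext y; rw [hmild y]; abel
  have hBc : Continuous B := by rw [hBeq]; exact hHc.sub hct
  have hBb : ∀ y, ‖B y‖ ≤ Ms + Mt := fun y => by
    rw [hBeq]; exact (norm_sub_le _ _).trans (add_le_add (hHb y) (hut y))
  -- the truncated field (bounded and measurable on all of `ℝ × ℝ³`), equal to `u` before `t`
  classical
  set w : ℝ → EuclideanSpace ℝ (Fin 3) → EuclideanSpace ℝ (Fin 3) :=
    fun τ y => if τ < t then u τ y else 0 with hw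
  have hwM : ∀ τ y, ‖w τ y‖ ≤ Mt := by
    intro τ y
    by_cases hτ : τ < t
    · simp only [hw, hτ, if_true]
      refine (hu.norm_le (hτ.trans ht) y).trans ?_
      exact div_le_div_of_nonneg_left hC (Real.sqrt_pos.2 (neg_pos.2 ht))
        (Real.sqrt_le_sqrt (by linarith))
    · simp only [hw, hτ, if_false, norm_zero]
      exact hMt0
  have hwmeas : Measurable (uncurry w) := by
    have e : uncurry w = (Iio t ×ˢ (univ : Set (EuclideanSpace ℝ (Fin 3)))).piecewise (uncurry u) 0 := by
      funext p
      rcases p with ⟨τ, y⟩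
      by_cases hτ : τ < t
      · have hp : (τ, y) ∈ Iio t ×ˢ (univ : Set (EuclideanSpace ℝ (Fin 3))) := ⟨hτ, mem_univ _⟩
        simp only [uncurry_apply_pair, hw, hτ, if_true, Set.piecewise_eq_of_mem _ _ _ hp]
      · have hp : (τ, y) ∉ Iio t ×ˢ (univ : Set (EuclideanSpace ℝ (Fin 3))) := fun h => hτ h.1
        simp only [uncurry_apply_pair, hw, hτ, if_false, Set.piecewise_eq_of_notMem _ _ _ hp,
          Pi.zero_apply]
    rw [e]
    refine ContinuousOn.measurable_piecewise ?_ continuousOn_const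
      (measurableSet_Iio.prod MeasurableSet.univ)
    exact hu.continuousOn_uncurry.mono (prod_mono (Iio_subset_Iio ht.le) Subset.rfl)
  have hBw : B = oseenDuhamel 1 s w w t := by
    funext y
    rw [hB, oseenDuhamel_apply, oseenDuhamel_apply]
    refine setIntegral_congr_fun measurableSet_Ioo fun τ hτ => ?_
    have hτ' : τ < t := hτ.2
    simp only [hw, hτ', if_true]
  -- ## the estimate for every averaging scale `ρ > 0`
  have key : ∀ ρ : ℝ, 0 < ρ → ‖bt - bs‖ ≤
      (t - s) * (oseenSliceConst (EuclideanSpace ℝ (Fin 3)) * ρ ^ (-(1 / 2 : ℝ)) * Mt * Mt) +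
        Nt * ρ ^ (-(1 / 4 : ℝ)) + Ns * ρ ^ (-(1 / 4 : ℝ)) := by
    intro ρ hρ
    have htsρ : 0 < t - s + ρ := by linarith
    -- (c) linearity of the heat average
    have h1 : heatExtension (u t) ρ 0 = heatExtension H ρ 0 - heatExtension B ρ 0 := by
      have e : u t = fun y => H y - B y := funext hmild
      rw [e]
      exact heatExtension_sub_of_bound hHc hBc hHb hBb hρ 0
    -- (d) the semigroup law
    have h2 : heatExtension H ρ 0 = heatExtension (u s) (t - s + ρ) 0 := by
      have hsg := heatExtension_add_holds (E := EuclideanSpace ℝ (Fin 3))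
        (F := EuclideanSpace ℝ (Fin 3)) (memLp_top_of_continuous_of_bound hcs hus) le_top hts hρ
      exact congrFun hsg 0
    -- (e) the heat flow shifts the clocks of the Duhamel term
    have h3 : heatExtension B ρ 0 =
        ∫ τ in Ioo s t, ∫ y, oseenKernel (1 * (t + ρ - τ)) (0 - y) (w τ y) (w τ y) := by
      have h := heatExtension_oseenDuhamel_eq_setIntegral (E := EuclideanSpace ℝ (Fin 3)) one_pos
        hwmeas hwM hst (lt_add_of_pos_right t hρ) (0 : EuclideanSpace ℝ (Fin 3))
      rw [show (1 : ℝ) * (t + ρ - t) = ρ by ring] at h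
      rw [hBw, h]
    -- (f) the shifted Duhamel term is `O(ρ^{-1/2})`
    have h4 : ‖heatExtension B ρ 0‖ ≤
        (t - s) * (oseenSliceConst (EuclideanSpace ℝ (Fin 3)) * ρ ^ (-(1 / 2 : ℝ)) * Mt * Mt) := by
      rw [h3]
      have hvol : volume (Ioo s t) < ∞ := measure_Ioo_lt_top
      have hb : ∀ τ ∈ Ioo s t,
          ‖∫ y, oseenKernel (1 * (t + ρ - τ)) (0 - y) (w τ y) (w τ y)‖ ≤
            oseenSliceConst (EuclideanSpace ℝ (Fin 3)) * ρ ^ (-(1 / 2 : ℝ)) * Mt * Mt := by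
        intro τ hτ
        have hσ : 0 < 1 * (t + ρ - τ) := by nlinarith [hτ.2]
        have hsl := norm_oseenSlice_le_oseenSliceConst hσ (hwM τ) (hwM τ) (0 : EuclideanSpace ℝ (Fin 3))
        rw [oseenSlice_apply] at hsl
        refine hsl.trans ?_
        have hρle : ρ ≤ 1 * (t + ρ - τ) := by nlinarith [hτ.2]
        have hpow : (1 * (t + ρ - τ)) ^ (-(1 / 2 : ℝ)) ≤ ρ ^ (-(1 / 2 : ℝ)) :=
          Real.rpow_le_rpow_of_nonpos hρ hρle (by norm_num)
        have hC0 := (oseenSliceConst_pos (E := EuclideanSpace ℝ (Fin 3))).le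
        gcongr
      refine (norm_setIntegral_le_of_norm_le_const hvol hb).trans_eq ?_
      rw [Real.volume_real_Ioo_of_le hst.le]
      ring
    -- (g) the caloric terms are close to the values at infinity
    have h5 : ‖heatExtension (u t) ρ 0 - bt‖ ≤ Nt * ρ ^ (-(1 / 4 : ℝ)) :=
      norm_heatExtension_sub_const_le hct hut bt hNt hvt hρ 0
    have h6 : ‖heatExtension (u s) (t - s + ρ) 0 - bs‖ ≤ Ns * ρ ^ (-(1 / 4 : ℝ)) := by
      refine (norm_heatExtension_sub_const_le hcs hus bs hNs hvs htsρ 0).trans ?_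
      exact mul_le_mul_of_nonneg_left
        (Real.rpow_le_rpow_of_nonpos hρ (by linarith) (by norm_num)) hNs
    -- (h) combine
    have e : bt - bs = -(heatExtension B ρ 0) - (heatExtension (u t) ρ 0 - bt) +
        (heatExtension (u s) (t - s + ρ) 0 - bs) := by
      rw [h1, h2]; abel
    calc ‖bt - bs‖ = ‖-(heatExtension B ρ 0) - (heatExtension (u t) ρ 0 - bt) +
          (heatExtension (u s) (t - s + ρ) 0 - bs)‖ := by rw [e]
      _ ≤ ‖-(heatExtension B ρ 0) - (heatExtension (u t) ρ 0 - bt)‖ +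
          ‖heatExtension (u s) (t - s + ρ) 0 - bs‖ := norm_add_le _ _
      _ ≤ ‖-(heatExtension B ρ 0)‖ + ‖heatExtension (u t) ρ 0 - bt‖ +
          ‖heatExtension (u s) (t - s + ρ) 0 - bs‖ := by
          gcongr
          exact norm_sub_le _ _
      _ ≤ _ := by
          rw [norm_neg]
          exact add_le_add (add_le_add h4 h5) h6
  -- ## let `ρ → ∞`
  have hlim : Tendsto (fun ρ : ℝ =>
      (t - s) * (oseenSliceConst (EuclideanSpace ℝ (Fin 3)) * ρ ^ (-(1 / 2 : ℝ)) * Mt * Mt) +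
        Nt * ρ ^ (-(1 / 4 : ℝ)) + Ns * ρ ^ (-(1 / 4 : ℝ))) atTop (𝓝 0) := by
    have h12 : Tendsto (fun ρ : ℝ => ρ ^ (-(1 / 2 : ℝ))) atTop (𝓝 0) :=
      tendsto_rpow_neg_atTop (by norm_num)
    have h14 : Tendsto (fun ρ : ℝ => ρ ^ (-(1 / 4 : ℝ))) atTop (𝓝 0) :=
      tendsto_rpow_neg_atTop (by norm_num)
    have hA : Tendsto (fun ρ : ℝ =>
        (t - s) * (oseenSliceConst (EuclideanSpace ℝ (Fin 3)) * ρ ^ (-(1 / 2 : ℝ)) * Mt * Mt))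
        atTop (𝓝 0) := by
      have := ((h12.const_mul (oseenSliceConst (EuclideanSpace ℝ (Fin 3)))).mul_const Mt).mul_const Mt
        |>.const_mul (t - s)
      simpa using this
    have hB' : Tendsto (fun ρ : ℝ => Nt * ρ ^ (-(1 / 4 : ℝ))) atTop (𝓝 0) := by
      simpa using h14.const_mul Nt
    have hC' : Tendsto (fun ρ : ℝ => Ns * ρ ^ (-(1 / 4 : ℝ))) atTop (𝓝 0) := by
      simpa using h14.const_mul Ns
    simpa using (hA.add hB').add hC'
  have hle : ‖bt - bs‖ ≤ 0 :=
    ge_of_tendsto hlim ((eventually_gt_atTop 0).mono fun ρ hρ => key ρ hρ)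
  exact sub_eq_zero.1 (norm_le_zero_iff.1 hle)

/-! ### The slices are in `L⁶` -/

/-- **The slices of a finite-dissipation Type-I ancient mild field are in `L⁶`, with
`‖u(s)‖_{L⁶} ≤ C_S ‖∇u(s)‖_{L²}`** (`C_S` universal): the value at infinity `b(s)` of the slice
(`exists_sub_const_eLpNorm_six_le`, `‖b(s)‖ ≤ C/√(−s)`) is independent of `s`
(`constAtInfinity_eq`) and tends to `0` as `s → −∞`, so it vanishes.
[cite: KochNadirashviliSereginSverak2009, proof of Thm. 6.1, last paragraph (arXiv:0709.3599 p. 12)] -/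
theorem exists_eLpNorm_six_slice_le :
    ∃ CS : ℝ≥0, ∀ (C : ℝ) (u : ℝ → EuclideanSpace ℝ (Fin 3) → EuclideanSpace ℝ (Fin 3)),
      IsTypeIAncientMild C u → (∀ s : ℝ, s < 0 → ∫⁻ x, ‖fderiv ℝ (u s) x‖ₑ ^ 2 < ∞) →
      ∀ s : ℝ, s < 0 → eLpNorm (u s) 6 volume ≤ CS * eLpNorm (fderiv ℝ (u s)) 2 volume := by
  obtain ⟨CS, hCS⟩ := exists_sub_const_eLpNorm_six_le (E := EuclideanSpace ℝ (Fin 3))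
    (F := EuclideanSpace ℝ (Fin 3)) (by rw [finrank_euclideanSpace, Fintype.card_fin])
  refine ⟨CS, fun C u hu hgrad => ?_⟩
  have hC : 0 ≤ C := hu.nonneg
  -- the slices are `C¹`, bounded, with gradient in `L²`
  have hmem : ∀ s : ℝ, s < 0 → MemLp (fderiv ℝ (u s)) 2 volume := by
    intro s hs
    have hcont : Continuous (fderiv ℝ (u s)) :=
      (hu.contDiff_slice hs).continuous_fderiv (by simp)
    refine ⟨hcont.aestronglyMeasurable, ?_⟩
    rw [eLpNorm_eq_lintegral_rpow_enorm_toReal two_ne_zero ENNReal.ofNat_ne_top]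
    refine ENNReal.rpow_lt_top_of_nonneg (by norm_num) (ne_of_lt ?_)
    have e : (fun x => ‖fderiv ℝ (u s) x‖ₑ ^ ((2 : ℝ≥0∞).toReal)) =
        fun x => ‖fderiv ℝ (u s) x‖ₑ ^ 2 := by
      funext x
      rw [ENNReal.toReal_ofNat, show (2 : ℝ) = ((2 : ℕ) : ℝ) by norm_num, ENNReal.rpow_natCast]
    rw [e]
    exact hgrad s hs
  -- the values at infinity
  have hb : ∀ s : ℝ, s < 0 → ∃ b : EuclideanSpace ℝ (Fin 3), ‖b‖ ≤ C / Real.sqrt (-s) ∧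
      eLpNorm (fun x => u s x - b) 6 volume ≤ CS * eLpNorm (fderiv ℝ (u s)) 2 volume :=
    fun s hs => hCS (u s) ((hu.contDiff_slice hs).of_le (by exact_mod_cast le_top))
      (C / Real.sqrt (-s)) (fun x => hu.norm_le hs x) (hmem s hs)
  choose! b hb using hb
  -- finite `L⁶` sizes
  have hN : ∀ s : ℝ, s < 0 → ∃ N : ℝ, 0 ≤ N ∧ eLpNorm (fun x => u s x - b s) 6 volume ≤ ENNReal.ofReal N := by
    intro s hs
    have hfin : (CS : ℝ≥0∞) * eLpNorm (fderiv ℝ (u s)) 2 volume ≠ ⊤ :=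
      ENNReal.mul_ne_top ENNReal.coe_ne_top (hmem s hs).2.ne
    refine ⟨((CS : ℝ≥0∞) * eLpNorm (fderiv ℝ (u s)) 2 volume).toReal, ENNReal.toReal_nonneg, ?_⟩
    rw [ENNReal.ofReal_toReal hfin]
    exact (hb s hs).2
  -- `b` is constant in time
  have hconst : ∀ s t : ℝ, s < t → t < 0 → b t = b s := by
    intro s t hst ht
    obtain ⟨Ns, hNs, hvs⟩ := hN s (hst.trans ht)
    obtain ⟨Nt, hNt, hvt⟩ := hN t ht
    exact constAtInfinity_eq hu hst ht hNs hNt hvs hvt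
  -- hence zero
  have hzero : ∀ s : ℝ, s < 0 → b s = 0 := by
    intro s hs
    have hbound : ∀ R : ℝ, -s < R → ‖b s‖ ≤ C / Real.sqrt R := by
      intro R hR
      have hR : -R < s := by linarith
      rw [hconst (-R) s hR hs]
      simpa only [neg_neg] using (hb (-R) (by linarith)).1
    have hlim : Tendsto (fun R : ℝ => C / Real.sqrt R) atTop (𝓝 0) := by
      have h := (tendsto_rpow_neg_atTop (by norm_num : (0 : ℝ) < 1 / 2)).const_mul C
      rw [mul_zero] at h
      refine h.congr' ((eventually_gt_atTop 0).mono fun R hR => ?_)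
      show C * R ^ (-(1 / 2 : ℝ)) = C / Real.sqrt R
      rw [Real.sqrt_eq_rpow, Real.rpow_neg hR.le]
      ring
    have hle : ‖b s‖ ≤ 0 := ge_of_tendsto hlim ((eventually_gt_atTop (-s)).mono fun R hR => hbound R hR)
    exact norm_le_zero_iff.1 hle
  intro s hs
  have h := (hb s hs).2
  simp only [hzero s hs, sub_zero] at h
  exact h

end Summit.NavierStokesRegularity.NavierStokesRegularity.Theorems.RecurrentReductionD

end
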